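import Summits.Ventures.Crystal3D.Theorems.StickyWulffConstantNoReconstructionGainExactCompatible
import Summits.Ventures.Crystal3D.Theorems.StickyWulffConstantNoReconstructionGainOffLattice
import HarnessLib

/-!
# The off-lattice part of a core: four off-lattice partners per ball, more than three contacts per ball
# (line `replication-exactness`, structure toward the residual)

HONEST FRAMING. Part of the venture `Summits/Ventures/Crystal3D` (cell `crystal3d-full`), supports the
crux `NoReconstructionGain` (stmt-Ventures-19144, route `route-Ventures-StickyWulffConstant`), line
`replication-exactness` (lead wulff-p1 g17).  The P-CORE versions (substrate = any finite set of lattice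
sites, film = the hypothesis of `adhesion_of_core`) of the criminal anatomy of `…ExactCriminalOffLattice`,
for the attack on the residual `stub_manyWrappedCoreAdhesion` (confinement of the off-lattice collar):

* `card_lattice_partners_le_three` — an off-lattice ball of a packing has at most `3` partners that are
  lattice sites (`fcc_offLattice_unitContacts_le_three`);
* `four_le_card_offLattice_partners_of_core` — in a P-core (`P ⊆ Λ₀`) every off-lattice film ball has
  at least FOUR off-lattice film partners (it has `≥ 7` partners, `seven_le_card_partners_of_core`);
* `contactDeficiency_offLattice_lt_of_core` — **the block of off-lattice film balls of a P-core, if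
  nonempty, has `D < 3·#`: more than three internal contacts per ball** (the core inequality at that
  block: its bonds to the rest are lattice contacts of off-lattice balls, `≤ 3` each).

WHAT THIS IS NOT: a confinement or counting bound for the off-lattice block; rung F-C1 not moved.
-/

noncomputable section

namespace Summit.Ventures.Crystal3D.Theorems

open Summit.Ventures.Crystal3D
open Literature.MathematicalPhysics.StatisticalMechanics (fccStacking contactDeficiency orderedContacts)
open scoped InnerProductSpace
open Finset

open scoped Classical in
/-- An off-lattice ball has at most three partners among the lattice sites of a packing. -/
theorem card_lattice_partners_le_three (X : Finset (EuclideanSpace ℝ (Fin 3)))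
    {q : EuclideanSpace ℝ (Fin 3)} (hqΛ : q ∉ fccStacking 1 (Real.sqrt (2 / 3))) :
    (X.filter fun y => y ∈ fccStacking 1 (Real.sqrt (2 / 3)) ∧ dist q y = 1).card ≤ 3 :=
  fcc_offLattice_unitContacts_le_three q hqΛ _ fun _ hy => (Finset.mem_filter.1 hy).2

open scoped Classical in
/-- **In a P-core every off-lattice film ball has at least four off-lattice film partners.** -/
theorem four_le_card_offLattice_partners_of_core (X P : Finset (EuclideanSpace ℝ (Fin 3)))
    (hPΛ : ∀ p ∈ P, p ∈ fccStacking 1 (Real.sqrt (2 / 3)))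
    (hcore : ∀ S, S ⊆ X \ P → S.Nonempty →
      contactDeficiency S < (((((X \ S) ×ˢ S).filter fun pq => dist pq.1 pq.2 = 1).card : ℕ) : ℝ))
    {q : EuclideanSpace ℝ (Fin 3)} (hq : q ∈ X \ P) (hqΛ : q ∉ fccStacking 1 (Real.sqrt (2 / 3))) :
    4 ≤ ((X \ P).filter fun y => y ∉ fccStacking 1 (Real.sqrt (2 / 3)) ∧ dist q y = 1).card := by
  have h7 := seven_le_card_partners_of_core X P hcore q hq
  have h3 := card_lattice_partners_le_three X hqΛ
  -- partners split into lattice sites and off-lattice film balls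
  have hle : (X.filter fun x => dist q x = 1).card ≤
      (X.filter fun y => y ∈ fccStacking 1 (Real.sqrt (2 / 3)) ∧ dist q y = 1).card +
        ((X \ P).filter fun y => y ∉ fccStacking 1 (Real.sqrt (2 / 3)) ∧ dist q y = 1).card := by
    rw [← Finset.card_union_of_disjoint]
    · refine Finset.card_le_card fun y hy => ?_
      rw [Finset.mem_filter] at hy
      rw [Finset.mem_union, Finset.mem_filter, Finset.mem_filter, Finset.mem_sdiff]
      by_cases hyΛ : y ∈ fccStacking 1 (Real.sqrt (2 / 3))
      · exact Or.inl ⟨hy.1, hyΛ, hy.2⟩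
      · exact Or.inr ⟨⟨hy.1, fun hyP => hyΛ (hPΛ y hyP)⟩, hyΛ, hy.2⟩
    · rw [Finset.disjoint_left]
      intro y hy hy'
      exact (Finset.mem_filter.1 hy').2.1 (Finset.mem_filter.1 hy).2.1
  omega

open scoped Classical in
/-- **The off-lattice block of a P-core has more than three contacts per ball**: `D(F_off) < 3·#F_off`
whenever it is nonempty. -/
theorem contactDeficiency_offLattice_lt_of_core (X P : Finset (EuclideanSpace ℝ (Fin 3)))
    (hPΛ : ∀ p ∈ P, p ∈ fccStacking 1 (Real.sqrt (2 / 3)))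
    (hcore : ∀ S, S ⊆ X \ P → S.Nonempty →
      contactDeficiency S < (((((X \ S) ×ˢ S).filter fun pq => dist pq.1 pq.2 = 1).card : ℕ) : ℝ))
    (hne : ((X \ P).filter fun y => y ∉ fccStacking 1 (Real.sqrt (2 / 3))).Nonempty) :
    contactDeficiency ((X \ P).filter fun y => y ∉ fccStacking 1 (Real.sqrt (2 / 3))) <
      3 * (((X \ P).filter fun y => y ∉ fccStacking 1 (Real.sqrt (2 / 3))).card : ℝ) := by
  set O := (X \ P).filter fun y => y ∉ fccStacking 1 (Real.sqrt (2 / 3)) with hO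
  have hOF : O ⊆ X \ P := Finset.filter_subset _ _
  have hblock := hcore O hOF hne
  -- bonds from the rest into `O` end at lattice sites: at most `3` per ball of `O`
  have hrest : ∀ y ∈ X \ O, ∀ q ∈ O, dist y q = 1 → y ∈ fccStacking 1 (Real.sqrt (2 / 3)) := by
    intro y hy q _ _
    rw [Finset.mem_sdiff] at hy
    by_contra hyΛ
    apply hy.2
    rw [hO, Finset.mem_filter, Finset.mem_sdiff]
    exact ⟨⟨hy.1, fun hyP => hyΛ (hPΛ y hyP)⟩, hyΛ⟩
  have hcross : (((X \ O) ×ˢ O).filter fun pq => dist pq.1 pq.2 = 1).card ≤ 3 * O.card := by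
    rw [card_cross_eq_sum]
    calc ∑ q ∈ O, ((X \ O).filter fun y => dist y q = 1).card ≤ ∑ q ∈ O, 3 := by
          refine Finset.sum_le_sum fun q hq => ?_
          have hqΛ := (Finset.mem_filter.1 hq).2
          refine le_trans (Finset.card_le_card fun y hy => ?_) (card_lattice_partners_le_three X hqΛ)
          rw [Finset.mem_filter] at hy ⊢
          exact ⟨(Finset.mem_sdiff.1 hy.1).1, hrest y hy.1 q hq hy.2, by rw [dist_comm]; exact hy.2⟩
      _ = 3 * O.card := by rw [Finset.sum_const, smul_eq_mul, mul_comm]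
  have hcross' : ((((X \ O) ×ˢ O).filter fun pq => dist pq.1 pq.2 = 1).card : ℝ) ≤ 3 * (O.card : ℝ) := by
    exact_mod_cast hcross
  linarith

end Summit.Ventures.Crystal3D.Theorems

end
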